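import Mathlib
import HarnessLib
import Summits.Ventures.LatticeQCDFlow.Exactness.SUNResidualLayerJacobian
import Summits.Ventures.LatticeQCDFlow.Exactness.SUNStoutLatticeLayer

/-!
# The masked `SU(N)` STOUT layer on the periodic lattice is exact for product Haar, for every `N`, `d`, `L`

HONEST FRAMING: exact (Metropolis-corrected) sampling algorithms for lattice gauge theory;
figures of merit are autocorrelation/cost numbers at stated couplings and volumes; no
continuum-physics claim.

Venture `LatticeQCDFlow` (cell pub-lqcd), topic `Exactness`; FANOUT row 10 (`eng-equiv`; engine
`equiv/residual.py` stout / stout-defect layers, `flows_jax/layers.py` `SU(N)` stout with closed-form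
log-det, `flows_jax/residual_flow.py`).  NEW WORK of the cell: the concrete instance of
`SUNResidualLayerJacobian.hasJacobian_sunResidualLayer` for the engine's STOUT layer of
`SUNStoutLatticeLayer` — active links `e = (x, μ)` replaced by `e^{ρ_e 𝒫(Ω_{x,μ}(V))} V(x,μ)`, `𝒫`
Lüscher's projection onto `𝔰𝔲(n)`, `Ω` the sum of the `2(d−1)` plaquette loops through the link —
under the frozen-staple mask hypotheses `h1`–`h6` of that file and the certificate `2(d−1)|ρ_e| < 1`.
The ambient `C²` realisation of the exponent is `ρ · 𝒫(loopSumAmb)` (WilsonFlow's polynomial loop sum),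
so the only extra hypothesis is that the coefficient read from the frozen links has a `C²` ambient
realisation — none for constant coefficients.  No definition is introduced.

* **`hasJacobian_sunStoutLatticeLayer`** — frozen-link coefficients `ρ V e = R e (V|frozen)` with a `C²`
  ambient realisation `Ramb`: `∃ J` continuous, `> 0`, `HasJacobian (⊗_e Haar_{SU(n)}) (stout layer) (ofReal ∘ J)`;
* **`hasJacobian_sunStoutLatticeLayer_const`** — the classic stout step with one constant parameter
  `r`, `2(d−1)|r| < 1` (the engine's `|ρ| < 1/2, 1/4, 1/6` for `d = 2, 3, 4`): exact for product Haar on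
  `GaugeConfig d L SU(n)`, every `n`, `d`, `L ≥ 1`, every admissible mask;
* `exists_measurableEquiv_sunStoutLatticeLayer_hasJacobian` — the same layer as an exact measurable
  AUTOMORPHISM (`HasJacobian (⊗Haar) Ψ (ofReal ∘ J)`, the hypothesis of `map_withDensity_equiv`, flow-MCMC,
  FT-HMC); `exists_wilsonWeight_eq_reweight_sunStoutLatticeLayer` — E3
  (`wilson_flow_reweighting_exact`) for the stout step with its `HasJacobian` hypothesis discharged;
* `hasJacobian_sunStoutLatticeLayer_directionMask` — the engine's generalized-checkerboard direction
  masks (`p (x,μ') ↔ μ' = μ ∧ φ x = c`, `φ(ν̂) ≠ 0` for `ν ≠ μ`; `directionMask_staples_frozen`) qualify;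
* `exists_pinched_of_continuous_pos`, `exists_stoutLayer_fthmc_data`,
  `exists_stoutLayer_fthmc_data_of_frozenCoeff` — by compactness the continuous positive Jacobian is
  pinched, `0 < j₁ ≤ J ≤ j₂`: the package `Ψ, J, j₁, j₂` (measurable `J`, `HasJacobian`) that row 14's
  FT-HMC theorems (`SUNLeapfrogFTHMCErgodic`) and the flow-sampler ergodicity theorems consume —
  used by `SUNStoutFTHMCErgodic` and `SUNStoutFlowSamplerErgodic`.

Printed counterparts, NAMED ONLY: Morningstar–Peardon, PRD 69 (2004) 054501 (stout smearing);
M. Lüscher, CMP 293 (2010) 899, §3; Abbott et al., arXiv:2305.02402 §4.2.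
-/

noncomputable section

namespace Summit.Ventures.LatticeQCDFlow.Exactness

open Literature.MathematicalPhysics.QuantumFieldTheory
open Literature.MathematicalPhysics.QuantumFieldTheory.Luscher2010
open Literature.MathematicalPhysics.QuantumFieldTheory.WilsonFlow
open MeasureTheory Filter Set
open scoped Matrix Matrix.Norms.Frobenius Topology ContDiff ENNReal

variable {d L n : ℕ} [NeZero L]

/-- **The masked `SU(N)` stout layer is exact for product Haar** (every `n`, `d`, `L ≥ 1`).
Hypotheses: the frozen-staple mask conditions `h1`–`h6` of `SUNStoutLatticeLayer`, a coefficient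
`ρ V e = R e (V|frozen)` reading frozen links with a `C²` ambient realisation `Ramb e`, and the
certificate `2(d−1)|R e y| < 1`.  Conclusion: a continuous positive `J` with
`HasJacobian (⊗_e Haar_{SU(n)}) (V ↦ (e ↦ e^{ρ 𝒫(Ω_e(V))} V e` on active, `V e` on frozen`)) (ofReal ∘ J)`. -/
theorem hasJacobian_sunStoutLatticeLayer (p : Edge d L → Prop) [DecidablePred p]
    (ρ : GaugeConfig d L (Matrix.specialUnitaryGroup (Fin n) ℂ) → Edge d L → ℝ)
    (R : (e : Edge d L) → ({f : Edge d L // ¬p f} → Matrix.specialUnitaryGroup (Fin n) ℂ) → ℝ)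
    (hR : ∀ V e, p e → ρ V e = R e (fun f => V f))
    (h1 : ∀ e, p e → ∀ ν, ν ≠ e.2 → ¬p (e.1.shift e.2, ν))
    (h2 : ∀ e, p e → ∀ ν, ν ≠ e.2 → ¬p (e.1.shift ν, e.2))
    (h3 : ∀ e, p e → ∀ ν, ν ≠ e.2 → ¬p (e.1, ν))
    (h4 : ∀ e, p e → ∀ ν, ν ≠ e.2 → ¬p ((e.1 - Pi.single ν 1).shift e.2, ν))
    (h5 : ∀ e, p e → ∀ ν, ν ≠ e.2 → ¬p (e.1 - Pi.single ν 1, e.2))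
    (h6 : ∀ e, p e → ∀ ν, ν ≠ e.2 → ¬p (e.1 - Pi.single ν 1, ν))
    (hκ : ∀ e y, p e → 2 * (d - 1 : ℝ) * |R e y| < 1)
    (Ramb : Edge d L → AmbConfig d L n → ℝ) (hRamb2 : ∀ e, ContDiff ℝ 2 (Ramb e))
    (hRambR : ∀ (V : GaugeConfig d L (Matrix.specialUnitaryGroup (Fin n) ℂ)) e, p e →
      Ramb e (coeConfig V) = R e (fun f => V f)) :
    ∃ J : GaugeConfig d L (Matrix.specialUnitaryGroup (Fin n) ℂ) → ℝ,
      Continuous J ∧ (∀ U, 0 < J U) ∧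
      HasJacobian (Measure.pi fun _ : Edge d L => haarProbability (Matrix.specialUnitaryGroup (Fin n) ℂ))
        (fun (V : GaugeConfig d L (Matrix.specialUnitaryGroup (Fin n) ℂ)) (e : Edge d L) =>
          if p e then
            (⟨NormedSpace.exp ((ρ V e : ℂ) • suProj (plaquetteLoopSum V e.1 e.2)),
                exp_smul_suProj_mem (ρ V e) (plaquetteLoopSum V e.1 e.2)⟩ :
              Matrix.specialUnitaryGroup (Fin n) ℂ) * V e
          else V e)
        (fun U => ENNReal.ofReal (J U)) := by
  rw [sunStoutLayer_eq_coupleFun p ρ R hR h1 h2 h3 h4 h5 h6]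
  -- the staple sum read off the frozen links, and the fibre exponent
  set S : {e : Edge d L // p e} → ({f : Edge d L // ¬p f} → Matrix.specialUnitaryGroup (Fin n) ℂ) →
      Matrix (Fin n) (Fin n) ℂ := fun a y =>
    ∑ ν : Fin d, if hν : ν = a.1.2 then (0 : Matrix (Fin n) (Fin n) ℂ) else
      (((y ⟨_, h1 a.1 a.2 ν hν⟩ * (y ⟨_, h2 a.1 a.2 ν hν⟩)⁻¹ * (y ⟨_, h3 a.1 a.2 ν hν⟩)⁻¹ :
          Matrix.specialUnitaryGroup (Fin n) ℂ) : Matrix (Fin n) (Fin n) ℂ) +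
        (((y ⟨_, h4 a.1 a.2 ν hν⟩)⁻¹ * (y ⟨_, h5 a.1 a.2 ν hν⟩)⁻¹ * y ⟨_, h6 a.1 a.2 ν hν⟩ :
          Matrix.specialUnitaryGroup (Fin n) ℂ) : Matrix (Fin n) (Fin n) ℂ)) with hS
  set Q : {e : Edge d L // p e} → ({f : Edge d L // ¬p f} → Matrix.specialUnitaryGroup (Fin n) ℂ) →
      Matrix (Fin n) (Fin n) ℂ → Matrix (Fin n) (Fin n) ℂ := fun a y u => (R a.1 y : ℂ) • suProj (u * S a y) with hQ
  have hQsk : ∀ a y, ∀ U ∈ Matrix.specialUnitaryGroup (Fin n) ℂ, (Q a y U)ᴴ = -Q a y U ∧ (Q a y U).trace = 0 :=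
    fun a y U _ => smul_suProj_skew (R a.1 y) _
  -- the fibres of `sunStoutLayer_eq_coupleFun` are the residual fibres `u ↦ e^{Q a y u} u`
  have hfib : (fun a y (u : Matrix.specialUnitaryGroup (Fin n) ℂ) =>
      (⟨NormedSpace.exp ((R a.1 y : ℂ) • suProj ((u : Matrix (Fin n) (Fin n) ℂ) *
          ∑ ν : Fin d, if hν : ν = a.1.2 then (0 : Matrix (Fin n) (Fin n) ℂ) else
            (((y ⟨_, h1 a.1 a.2 ν hν⟩ * (y ⟨_, h2 a.1 a.2 ν hν⟩)⁻¹ * (y ⟨_, h3 a.1 a.2 ν hν⟩)⁻¹ :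
                Matrix.specialUnitaryGroup (Fin n) ℂ) : Matrix (Fin n) (Fin n) ℂ) +
              (((y ⟨_, h4 a.1 a.2 ν hν⟩)⁻¹ * (y ⟨_, h5 a.1 a.2 ν hν⟩)⁻¹ * y ⟨_, h6 a.1 a.2 ν hν⟩ :
                Matrix.specialUnitaryGroup (Fin n) ℂ) : Matrix (Fin n) (Fin n) ℂ)))),
        exp_smul_suProj_mem _ _⟩ : Matrix.specialUnitaryGroup (Fin n) ℂ) * u) =
      fun a y (u : Matrix.specialUnitaryGroup (Fin n) ℂ) =>
        (⟨NormedSpace.exp (Q a y u) * u, residual_value_mem (hQsk a y) u.2⟩ :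
          Matrix.specialUnitaryGroup (Fin n) ℂ) := by
    funext a y u
    exact Subtype.ext rfl
  rw [hfib]
  -- the staples are unitary, so the exponent is `2(d−1)|R|`-Lipschitz
  have hlip : ∀ a y, ∀ U ∈ Matrix.specialUnitaryGroup (Fin n) ℂ, ∀ V ∈ Matrix.specialUnitaryGroup (Fin n) ℂ,
      frobNorm (Q a y U - Q a y V) ≤ (2 * (d - 1 : ℝ) * |R a.1 y|) * frobNorm (U - V) := by
    intro a y U _ V _
    exact frobNorm_stoutFibreExponent_sub_le (R a.1 y) a.1.2
      (fun ν hν => (y ⟨_, h1 a.1 a.2 ν hν⟩ * (y ⟨_, h2 a.1 a.2 ν hν⟩)⁻¹ * (y ⟨_, h3 a.1 a.2 ν hν⟩)⁻¹).2.1)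
      (fun ν hν => ((y ⟨_, h4 a.1 a.2 ν hν⟩)⁻¹ * (y ⟨_, h5 a.1 a.2 ν hν⟩)⁻¹ * y ⟨_, h6 a.1 a.2 ν hν⟩).2.1) U V
  have hκ0 : ∀ (a : {e : Edge d L // p e}) (y : {f : Edge d L // ¬p f} → Matrix.specialUnitaryGroup (Fin n) ℂ),
      0 ≤ 2 * (d - 1 : ℝ) * |R a.1 y| := by
    intro a y
    have hd : (1 : ℝ) ≤ d := by exact_mod_cast Fin.pos a.1.2
    exact mul_nonneg (by linarith) (abs_nonneg _)
  -- the ambient realisation `ρ · 𝒫(loopSumAmb)`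
  set Qamb : {e : Edge d L // p e} → AmbConfig d L n → Matrix (Fin n) (Fin n) ℂ :=
    fun a W => (Ramb a.1 W : ℂ) • suProj (loopSumAmb W a.1.1 a.1.2) with hQamb
  have hQ2 : ∀ a, ContDiff ℝ 2 (Qamb a) := fun a =>
    (Complex.ofRealCLM.contDiff.comp (hRamb2 a.1)).smul (contDiff_suProj.comp (contDiff_loopSumAmb a.1.1 a.1.2))
  have hQambQ : ∀ a (U : GaugeConfig d L (Matrix.specialUnitaryGroup (Fin n) ℂ)),
      Qamb a (coeConfig U) = Q a (fun f => U f) (U a.1 : Matrix (Fin n) (Fin n) ℂ) := by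
    intro a U
    simp only [hQamb, hQ, hS]
    rw [hRambR U a.1 a.2, loopSumAmb_coeConfig, plaquetteLoopSum_eq_link_mul]
    rfl
  exact hasJacobian_sunResidualLayer p Q (fun a y => 2 * (d - 1 : ℝ) * |R a.1 y|) Qamb hQsk hlip hκ0
    (fun a y => hκ a.1 y a.2) hQ2 hQambQ

/-- **The classic stout step is exact for product Haar, every `N`, `d`, `L`**: one constant
parameter `r` with `2(d−1)|r| < 1` on every active link of a mask meeting the frozen-staple
hypotheses `h1`–`h6` (e.g. the engine's generalized-checkerboard direction masks,
`directionMask_staples_frozen`). -/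
theorem hasJacobian_sunStoutLatticeLayer_const (p : Edge d L → Prop) [DecidablePred p] (r : ℝ)
    (h1 : ∀ e, p e → ∀ ν, ν ≠ e.2 → ¬p (e.1.shift e.2, ν))
    (h2 : ∀ e, p e → ∀ ν, ν ≠ e.2 → ¬p (e.1.shift ν, e.2))
    (h3 : ∀ e, p e → ∀ ν, ν ≠ e.2 → ¬p (e.1, ν))
    (h4 : ∀ e, p e → ∀ ν, ν ≠ e.2 → ¬p ((e.1 - Pi.single ν 1).shift e.2, ν))
    (h5 : ∀ e, p e → ∀ ν, ν ≠ e.2 → ¬p (e.1 - Pi.single ν 1, e.2))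
    (h6 : ∀ e, p e → ∀ ν, ν ≠ e.2 → ¬p (e.1 - Pi.single ν 1, ν))
    (hr : 2 * (d - 1 : ℝ) * |r| < 1) :
    ∃ J : GaugeConfig d L (Matrix.specialUnitaryGroup (Fin n) ℂ) → ℝ,
      Continuous J ∧ (∀ U, 0 < J U) ∧
      HasJacobian (Measure.pi fun _ : Edge d L => haarProbability (Matrix.specialUnitaryGroup (Fin n) ℂ))
        (fun (V : GaugeConfig d L (Matrix.specialUnitaryGroup (Fin n) ℂ)) (e : Edge d L) =>
          if p e then
            (⟨NormedSpace.exp ((r : ℂ) • suProj (plaquetteLoopSum V e.1 e.2)),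
                exp_smul_suProj_mem r (plaquetteLoopSum V e.1 e.2)⟩ :
              Matrix.specialUnitaryGroup (Fin n) ℂ) * V e
          else V e)
        (fun U => ENNReal.ofReal (J U)) :=
  hasJacobian_sunStoutLatticeLayer p (fun _ _ => r) (fun _ _ => r) (fun _ _ _ => rfl) h1 h2 h3 h4 h5 h6
    (fun _ _ _ => hr) (fun _ _ => r) (fun _ => contDiff_const) (fun _ _ _ => rfl)

/-- **… as an exact measurable AUTOMORPHISM**: when the coefficient depends continuously on the frozen
links, the stout layer is `⇑Ψ` for a measurable equivalence `Ψ` of `GaugeConfig d L SU(n)`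
(`exists_measurableEquiv_sunStoutLatticeLayer`) with `HasJacobian (⊗Haar) Ψ (ofReal ∘ J)`, `J`
continuous and positive — the joint hypothesis of `HasJacobian.map_withDensity_equiv`, of the
flow-MCMC theorems and of the FT-HMC theorems, for the `SU(N)` stout layer, every `N`. -/
theorem exists_measurableEquiv_sunStoutLatticeLayer_hasJacobian (p : Edge d L → Prop) [DecidablePred p]
    (ρ : GaugeConfig d L (Matrix.specialUnitaryGroup (Fin n) ℂ) → Edge d L → ℝ)
    (R : (e : Edge d L) → ({f : Edge d L // ¬p f} → Matrix.specialUnitaryGroup (Fin n) ℂ) → ℝ)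
    (hR : ∀ V e, p e → ρ V e = R e (fun f => V f)) (hRc : ∀ e, p e → Continuous (R e))
    (h1 : ∀ e, p e → ∀ ν, ν ≠ e.2 → ¬p (e.1.shift e.2, ν))
    (h2 : ∀ e, p e → ∀ ν, ν ≠ e.2 → ¬p (e.1.shift ν, e.2))
    (h3 : ∀ e, p e → ∀ ν, ν ≠ e.2 → ¬p (e.1, ν))
    (h4 : ∀ e, p e → ∀ ν, ν ≠ e.2 → ¬p ((e.1 - Pi.single ν 1).shift e.2, ν))
    (h5 : ∀ e, p e → ∀ ν, ν ≠ e.2 → ¬p (e.1 - Pi.single ν 1, e.2))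
    (h6 : ∀ e, p e → ∀ ν, ν ≠ e.2 → ¬p (e.1 - Pi.single ν 1, ν))
    (hκ : ∀ e y, p e → 2 * (d - 1 : ℝ) * |R e y| < 1)
    (Ramb : Edge d L → AmbConfig d L n → ℝ) (hRamb2 : ∀ e, ContDiff ℝ 2 (Ramb e))
    (hRambR : ∀ (V : GaugeConfig d L (Matrix.specialUnitaryGroup (Fin n) ℂ)) e, p e →
      Ramb e (coeConfig V) = R e (fun f => V f)) :
    ∃ (Ψ : GaugeConfig d L (Matrix.specialUnitaryGroup (Fin n) ℂ) ≃ᵐ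
        GaugeConfig d L (Matrix.specialUnitaryGroup (Fin n) ℂ))
      (J : GaugeConfig d L (Matrix.specialUnitaryGroup (Fin n) ℂ) → ℝ),
      (⇑Ψ = fun (V : GaugeConfig d L (Matrix.specialUnitaryGroup (Fin n) ℂ)) (e : Edge d L) =>
        if p e then
          (⟨NormedSpace.exp ((ρ V e : ℂ) • suProj (plaquetteLoopSum V e.1 e.2)),
              exp_smul_suProj_mem (ρ V e) (plaquetteLoopSum V e.1 e.2)⟩ :
            Matrix.specialUnitaryGroup (Fin n) ℂ) * V e
        else V e) ∧ Continuous J ∧ (∀ U, 0 < J U) ∧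
      HasJacobian (Measure.pi fun _ : Edge d L => haarProbability (Matrix.specialUnitaryGroup (Fin n) ℂ))
        Ψ (fun U => ENNReal.ofReal (J U)) := by
  obtain ⟨Ψ, hΨ⟩ := exists_measurableEquiv_sunStoutLatticeLayer p ρ R hR hRc h1 h2 h3 h4 h5 h6 hκ
  obtain ⟨J, hJc, hJ0, hJ⟩ := hasJacobian_sunStoutLatticeLayer p ρ R hR h1 h2 h3 h4 h5 h6 hκ Ramb hRamb2 hRambR
  refine ⟨Ψ, J, hΨ, hJc, hJ0, ?_⟩
  rw [← hΨ] at hJ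
  exact hJ

/-- **E3 with its hypothesis discharged, for the `SU(N)` stout step**
(`FlowPushforward.wilson_flow_reweighting_exact`, whose docstring records that "certifying
`HasJacobian` for [the gauge-equivariant layers] needs the Haar volume form on the Lie group"): for
the constant-parameter stout step there is a continuous positive `J` such that the prior
`(q ∘ layer) · J · ⊗Haar` pushed through the layer and reweighted by `e^{−βS_W}/q` IS the tree's
un-normalised Wilson weight `wilsonWeight ρ β`, for every representation `ρ` with measurable Wilson
action, every `β`, every model density `q`. -/
theorem exists_wilsonWeight_eq_reweight_sunStoutLatticeLayer {N : ℕ}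
    (ρ : Matrix.specialUnitaryGroup (Fin n) ℂ →* Matrix (Fin N) (Fin N) ℂ) (β : ℝ)
    (hSW : Measurable (wilsonAction (d := d) (L := L) ρ))
    (p : Edge d L → Prop) [DecidablePred p] (r : ℝ)
    (h1 : ∀ e, p e → ∀ ν, ν ≠ e.2 → ¬p (e.1.shift e.2, ν))
    (h2 : ∀ e, p e → ∀ ν, ν ≠ e.2 → ¬p (e.1.shift ν, e.2))
    (h3 : ∀ e, p e → ∀ ν, ν ≠ e.2 → ¬p (e.1, ν))
    (h4 : ∀ e, p e → ∀ ν, ν ≠ e.2 → ¬p ((e.1 - Pi.single ν 1).shift e.2, ν))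
    (h5 : ∀ e, p e → ∀ ν, ν ≠ e.2 → ¬p (e.1 - Pi.single ν 1, e.2))
    (h6 : ∀ e, p e → ∀ ν, ν ≠ e.2 → ¬p (e.1 - Pi.single ν 1, ν))
    (hr : 2 * (d - 1 : ℝ) * |r| < 1)
    {q : GaugeConfig d L (Matrix.specialUnitaryGroup (Fin n) ℂ) → ℝ≥0∞} (hq : Measurable q)
    (hq0 : ∀ U, q U ≠ 0) (hqtop : ∀ U, q U ≠ (⊤ : ℝ≥0∞)) :
    ∃ J : GaugeConfig d L (Matrix.specialUnitaryGroup (Fin n) ℂ) → ℝ, Continuous J ∧ (∀ U, 0 < J U) ∧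
      (Measure.map
          (fun (V : GaugeConfig d L (Matrix.specialUnitaryGroup (Fin n) ℂ)) (e : Edge d L) =>
            if p e then
              (⟨NormedSpace.exp ((r : ℂ) • suProj (plaquetteLoopSum V e.1 e.2)),
                  exp_smul_suProj_mem r (plaquetteLoopSum V e.1 e.2)⟩ :
                Matrix.specialUnitaryGroup (Fin n) ℂ) * V e
            else V e)
          ((Measure.pi fun _ : Edge d L => haarProbability (Matrix.specialUnitaryGroup (Fin n) ℂ)).withDensity
            fun V => q (fun e : Edge d L =>
                if p e then
                  (⟨NormedSpace.exp ((r : ℂ) • suProj (plaquetteLoopSum V e.1 e.2)),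
                      exp_smul_suProj_mem r (plaquetteLoopSum V e.1 e.2)⟩ :
                    Matrix.specialUnitaryGroup (Fin n) ℂ) * V e
                else V e) * ENNReal.ofReal (J V))).withDensity
          (fun U => ENNReal.ofReal (Real.exp (-β * wilsonAction ρ U)) / q U) =
        wilsonWeight ρ β := by
  obtain ⟨J, hJc, hJ0, hJ⟩ := hasJacobian_sunStoutLatticeLayer_const (n := n) p r h1 h2 h3 h4 h5 h6 hr
  exact ⟨J, hJc, hJ0, wilson_flow_reweighting_exact ρ β hJ hSW hq hq0 hqtop⟩

/-- **The engine's direction masks qualify** (`directionMask_staples_frozen`): for the mask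
`p (x, μ') ↔ μ' = μ ∧ φ x = c` with an additive phase `φ` moving along every other direction
(`φ(ν̂) ≠ 0` for `ν ≠ μ` — generalized checkerboard), the constant-parameter `SU(N)` stout step with
`2(d−1)|r| < 1` is exact for product Haar, every `n`, `d`, `L ≥ 1`. -/
theorem hasJacobian_sunStoutLatticeLayer_directionMask {A : Type*} [AddGroup A] [DecidableEq A]
    (φ : (Fin d → ZMod L) →+ A) (c : A) (μ : Fin d) (hφ : ∀ ν, ν ≠ μ → φ (Pi.single ν 1) ≠ 0)
    (r : ℝ) (hr : 2 * (d - 1 : ℝ) * |r| < 1) :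
    ∃ J : GaugeConfig d L (Matrix.specialUnitaryGroup (Fin n) ℂ) → ℝ,
      Continuous J ∧ (∀ U, 0 < J U) ∧
      HasJacobian (Measure.pi fun _ : Edge d L => haarProbability (Matrix.specialUnitaryGroup (Fin n) ℂ))
        (fun (V : GaugeConfig d L (Matrix.specialUnitaryGroup (Fin n) ℂ)) (e : Edge d L) =>
          if e.2 = μ ∧ φ e.1 = c then
            (⟨NormedSpace.exp ((r : ℂ) • suProj (plaquetteLoopSum V e.1 e.2)),
                exp_smul_suProj_mem r (plaquetteLoopSum V e.1 e.2)⟩ :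
              Matrix.specialUnitaryGroup (Fin n) ℂ) * V e
          else V e)
        (fun U => ENNReal.ofReal (J U)) :=
  hasJacobian_sunStoutLatticeLayer_const (n := n) (fun e : Edge d L => e.2 = μ ∧ φ e.1 = c) r
    (fun e he ν hν => (directionMask_staples_frozen φ c μ hφ e he ν hν).1)
    (fun e he ν hν => (directionMask_staples_frozen φ c μ hφ e he ν hν).2.1)
    (fun e he ν hν => (directionMask_staples_frozen φ c μ hφ e he ν hν).2.2.1)
    (fun e he ν hν => (directionMask_staples_frozen φ c μ hφ e he ν hν).2.2.2.1)
    (fun e he ν hν => (directionMask_staples_frozen φ c μ hφ e he ν hν).2.2.2.2.1)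
    (fun e he ν hν => (directionMask_staples_frozen φ c μ hφ e he ν hν).2.2.2.2.2)
    hr

/-! ## The data of row 14's FT-HMC theorems and of the flow sampler -/

omit [NeZero L] in
/-- A continuous positive function on a nonempty compact space is pinched between positive constants. -/
theorem exists_pinched_of_continuous_pos {X : Type*} [TopologicalSpace X] [CompactSpace X] [Nonempty X]
    {J : X → ℝ} (hJc : Continuous J) (hJ0 : ∀ x, 0 < J x) :
    ∃ j₁ j₂ : ℝ, 0 < j₁ ∧ (∀ x, j₁ ≤ J x) ∧ (∀ x, J x ≤ j₂) := by
  obtain ⟨x₁, -, h₁⟩ := isCompact_univ.exists_isMinOn Set.univ_nonempty hJc.continuousOn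
  obtain ⟨x₂, -, h₂⟩ := isCompact_univ.exists_isMaxOn Set.univ_nonempty hJc.continuousOn
  refine ⟨J x₁, J x₂, hJ0 x₁, fun x => ?_, fun x => ?_⟩
  · exact h₁ (Set.mem_univ x)
  · exact h₂ (Set.mem_univ x)

/-- **The stout layer carries the data of row 14's FT-HMC theorems**: a measurable equivalence `Ψ`
whose forward map is the constant-parameter masked `SU(N)` stout step, with a measurable Jacobian
pinched between positive constants. -/
theorem exists_stoutLayer_fthmc_data (p : Edge d L → Prop) [DecidablePred p] (r : ℝ)
    (h1 : ∀ e, p e → ∀ ν, ν ≠ e.2 → ¬p (e.1.shift e.2, ν))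
    (h2 : ∀ e, p e → ∀ ν, ν ≠ e.2 → ¬p (e.1.shift ν, e.2))
    (h3 : ∀ e, p e → ∀ ν, ν ≠ e.2 → ¬p (e.1, ν))
    (h4 : ∀ e, p e → ∀ ν, ν ≠ e.2 → ¬p ((e.1 - Pi.single ν 1).shift e.2, ν))
    (h5 : ∀ e, p e → ∀ ν, ν ≠ e.2 → ¬p (e.1 - Pi.single ν 1, e.2))
    (h6 : ∀ e, p e → ∀ ν, ν ≠ e.2 → ¬p (e.1 - Pi.single ν 1, ν))
    (hr : 2 * (d - 1 : ℝ) * |r| < 1) :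
    ∃ (Ψ : GaugeConfig d L (Matrix.specialUnitaryGroup (Fin n) ℂ) ≃ᵐ
        GaugeConfig d L (Matrix.specialUnitaryGroup (Fin n) ℂ))
      (J : GaugeConfig d L (Matrix.specialUnitaryGroup (Fin n) ℂ) → ℝ) (j₁ j₂ : ℝ),
      (⇑Ψ = fun (V : GaugeConfig d L (Matrix.specialUnitaryGroup (Fin n) ℂ)) (e : Edge d L) =>
        if p e then
          (⟨NormedSpace.exp ((r : ℂ) • suProj (plaquetteLoopSum V e.1 e.2)),
              exp_smul_suProj_mem r (plaquetteLoopSum V e.1 e.2)⟩ :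
            Matrix.specialUnitaryGroup (Fin n) ℂ) * V e
        else V e) ∧
      Measurable J ∧ 0 < j₁ ∧ (∀ v, j₁ ≤ J v) ∧ (∀ v, J v ≤ j₂) ∧
      HasJacobian (Measure.pi fun _ : Edge d L => haarProbability (Matrix.specialUnitaryGroup (Fin n) ℂ))
        Ψ (fun v => ENNReal.ofReal (J v)) := by
  obtain ⟨Ψ, J, hΨ, hJc, hJ0, hJ⟩ := exists_measurableEquiv_sunStoutLatticeLayer_hasJacobian (n := n) p
    (fun _ _ => r) (fun _ _ => r) (fun _ _ _ => rfl) (fun _ _ => continuous_const) h1 h2 h3 h4 h5 h6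
    (fun _ _ _ => hr) (fun _ _ => r) (fun _ => contDiff_const) (fun _ _ _ => rfl)
  obtain ⟨j₁, j₂, hj₁, hJ₁, hJ₂⟩ := exists_pinched_of_continuous_pos hJc hJ0
  exact ⟨Ψ, J, j₁, j₂, hΨ, hJc.measurable, hj₁, hJ₁, hJ₂, hJ⟩

/-- **The same for frozen-link (learned / conditioned) coefficients**: `ρ V e = R e (V|frozen)` with
`R e` continuous in the frozen links and a `C²` ambient realisation `Ramb e`, `2(d−1)|R e y| < 1` —
the data `Ψ, J, j₁, j₂` of row 14's FT-HMC theorems for the engine's conditioned stout layers. -/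
theorem exists_stoutLayer_fthmc_data_of_frozenCoeff (p : Edge d L → Prop) [DecidablePred p]
    (ρ : GaugeConfig d L (Matrix.specialUnitaryGroup (Fin n) ℂ) → Edge d L → ℝ)
    (R : (e : Edge d L) → ({f : Edge d L // ¬p f} → Matrix.specialUnitaryGroup (Fin n) ℂ) → ℝ)
    (hR : ∀ V e, p e → ρ V e = R e (fun f => V f)) (hRc : ∀ e, p e → Continuous (R e))
    (h1 : ∀ e, p e → ∀ ν, ν ≠ e.2 → ¬p (e.1.shift e.2, ν))
    (h2 : ∀ e, p e → ∀ ν, ν ≠ e.2 → ¬p (e.1.shift ν, e.2))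
    (h3 : ∀ e, p e → ∀ ν, ν ≠ e.2 → ¬p (e.1, ν))
    (h4 : ∀ e, p e → ∀ ν, ν ≠ e.2 → ¬p ((e.1 - Pi.single ν 1).shift e.2, ν))
    (h5 : ∀ e, p e → ∀ ν, ν ≠ e.2 → ¬p (e.1 - Pi.single ν 1, e.2))
    (h6 : ∀ e, p e → ∀ ν, ν ≠ e.2 → ¬p (e.1 - Pi.single ν 1, ν))
    (hκ : ∀ e y, p e → 2 * (d - 1 : ℝ) * |R e y| < 1)
    (Ramb : Edge d L → AmbConfig d L n → ℝ) (hRamb2 : ∀ e, ContDiff ℝ 2 (Ramb e))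
    (hRambR : ∀ (V : GaugeConfig d L (Matrix.specialUnitaryGroup (Fin n) ℂ)) e, p e →
      Ramb e (coeConfig V) = R e (fun f => V f)) :
    ∃ (Ψ : GaugeConfig d L (Matrix.specialUnitaryGroup (Fin n) ℂ) ≃ᵐ
        GaugeConfig d L (Matrix.specialUnitaryGroup (Fin n) ℂ))
      (J : GaugeConfig d L (Matrix.specialUnitaryGroup (Fin n) ℂ) → ℝ) (j₁ j₂ : ℝ),
      (⇑Ψ = fun (V : GaugeConfig d L (Matrix.specialUnitaryGroup (Fin n) ℂ)) (e : Edge d L) =>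
        if p e then
          (⟨NormedSpace.exp ((ρ V e : ℂ) • suProj (plaquetteLoopSum V e.1 e.2)),
              exp_smul_suProj_mem (ρ V e) (plaquetteLoopSum V e.1 e.2)⟩ :
            Matrix.specialUnitaryGroup (Fin n) ℂ) * V e
        else V e) ∧
      Measurable J ∧ 0 < j₁ ∧ (∀ v, j₁ ≤ J v) ∧ (∀ v, J v ≤ j₂) ∧
      HasJacobian (Measure.pi fun _ : Edge d L => haarProbability (Matrix.specialUnitaryGroup (Fin n) ℂ))
        Ψ (fun v => ENNReal.ofReal (J v)) := by
  obtain ⟨Ψ, J, hΨ, hJc, hJ0, hJ⟩ := exists_measurableEquiv_sunStoutLatticeLayer_hasJacobian (n := n) p ρ R hR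
    hRc h1 h2 h3 h4 h5 h6 hκ Ramb hRamb2 hRambR
  obtain ⟨j₁, j₂, hj₁, hJ₁, hJ₂⟩ := exists_pinched_of_continuous_pos hJc hJ0
  exact ⟨Ψ, J, j₁, j₂, hΨ, hJc.measurable, hj₁, hJ₁, hJ₂, hJ⟩

end Summit.Ventures.LatticeQCDFlow.Exactness

end
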